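import Mathlib
import HarnessLib
import Summits.Ventures.LatticeQCDFlow.Exactness.NCMCGeneralSpaceSwitchRate
import Summits.Ventures.LatticeQCDFlow.Exactness.NCMCGeneralSpaceOverlap

/-!
# Which level constant maximises the stationary switch rate? The BAR root is optimal within a factor two, and the rate is 1-log-Lipschitz in `c`

HONEST FRAMING: exact (Metropolis-corrected) sampling algorithms for lattice gauge theory;
figures of merit are autocorrelation/cost numbers at stated couplings and volumes; no
continuum-physics claim.

Venture `LatticeQCDFlow` (cell pub-lqcd), topic `Exactness`; FANOUT row 13 (`eng-snf`, GEN-13).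
NEW WORK of the cell (elementary), not a published result; nothing is cited as a fact.
Continuation of `NCMCGeneralSpaceSwitchRate.lean` (GEN-12), whose scope note left open "which `c`
maximises the rate for a given pair (that depends on the two work laws)".  The maximiser does depend
on the work laws — but NOT BY MUCH: this file shows that the free-energy difference (the BAR root
the engine tunes `ncmc.c` to, `ncmc.c_from_works`) loses at most a factor two against the best
level constant, for EVERY Crooks pair, and that the rate moves at most exponentially in `|c − ΔF|`.

## Setting and content

A Crooks pair `(κF, κR, s, e, W)` from `ν₀` to `ν₁` (general measurable `Ω`), a level constant `c`;
`p(c) = σ(c − ΔF)` the stationary occupancy of the target level (`NCMCGeneralSpaceOccupancy.lean`),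
`a_F(c) = E_{P_F}[min(1, e^{−(W−c)})]`, `a_R(c) = E_{P_R}[min(1, e^{W−c})]` the lane acceptances,
`rate(c) = (1 − p) a_F(c) + p a_R(c)` the stationary fraction of accepted switch proposals
(`= 2(1 − p) a_F = 2p a_R`, flow balance; `rate(ΔF) = a_F(ΔF) = 1 − TV(P_F, P_R)`).

* **`integral_accept_mono`** / **`integral_accept_rev_anti`** — `c ↦ a_F(c)` is non-decreasing and
  `c ↦ a_R(c)` non-increasing (on any probability law; pointwise monotonicity of the Metropolis
  factor); `integrable_accept_rev` (bookkeeping).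
* **`CrooksPair.switchRate_le_two_mul_sigmoid_mul_accept`** — THE UPPER SANDWICH:
  `rate(c) ≤ 2σ(|c − ΔF|) · a_F(ΔF)`.  (For `c ≤ ΔF` use `rate = 2(1 − p) a_F(c)`, `1 − p = σ(|c − ΔF|)`,
  `a_F(c) ≤ a_F(ΔF)`; for `c ≥ ΔF` use `rate = 2p a_R(c)`, `p = σ(|c − ΔF|)`, `a_R(c) ≤ a_R(ΔF) = a_F(ΔF)`.)
* **`CrooksPair.two_mul_sigmoid_mul_accept_le_switchRate`** — THE LOWER SANDWICH:
  `2σ(−|c − ΔF|) · a_F(ΔF) ≤ rate(c)` (the other flow-balance form in each case).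
* **`CrooksPair.switchRate_le_two_mul_switchRate_freeEnergyDiff`** — FACTOR-TWO OPTIMALITY OF THE
  BAR ROOT: `rate(c) ≤ 2 · rate(ΔF)` for every `c`; so `sup_c rate(c) ≤ 2 · rate(ΔF)` whatever the
  protocol: re-tuning `c` away from `ΔF` can never more than double the stationary switch rate.
* **`CrooksPair.exp_neg_mul_le_switchRate`** / **`CrooksPair.switchRate_le_exp_mul`** —
  `e^{−|c − ΔF|} · rate(ΔF) ≤ rate(c) ≤ e^{|c − ΔF|} · rate(ΔF)`: the stationary switch rate is
  1-log-Lipschitz in the level constant around the BAR root (`2σ(−|x|) ≥ e^{−|x|}`, `2σ(|x|) ≤ e^{|x|}`);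
  **`CrooksPair.abs_log_switchRate_sub_le`** — `|log rate(c) − log rate(ΔF)| ≤ |c − ΔF|` when
  `rate(ΔF) > 0`.  With GEN-12's cap `rate(c) ≤ 2σ(−|c − ΔF|)` this brackets the cost of a mistuned `c` from both
  sides in population, value-free.

Nothing is claimed about the exact maximiser for a given pair, about any value for a concrete
protocol, or about autocorrelations (the rate is a stationary one-step acceptance frequency).
-/

namespace Summit.Ventures.LatticeQCDFlow.Exactness.GeneralNCMC

open MeasureTheory ProbabilityTheory Set Filter
open scoped ENNReal

variable {Ω E : Type*} [MeasurableSpace Ω] [MeasurableSpace E]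

/-! ## Monotonicity of the lane acceptances in the level constant -/

/-- A Metropolis factor `min(1, e^{u})` with measurable exponent is integrable on a probability law
(bounded by one). -/
theorem integrable_min_one_exp (μ : Measure E) [IsProbabilityMeasure μ] {u : E → ℝ}
    (hu : Measurable u) : Integrable (fun ε => min 1 (Real.exp (u ε))) μ := by
  refine Integrable.of_bound (measurable_const.min (Real.measurable_exp.comp hu)).aestronglyMeasurable
    1 (Eventually.of_forall fun ε => ?_)
  rw [Real.norm_eq_abs, abs_of_nonneg (le_min zero_le_one (Real.exp_pos _).le)]
  exact min_le_left _ _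

/-- **`c ↦ a_F(c) = E_μ[min(1, e^{−(W−c)})]` is non-decreasing** (raising the level constant makes
every up-switch more acceptable). -/
theorem integral_accept_mono (μ : Measure E) [IsProbabilityMeasure μ] {W : E → ℝ}
    (hW : Measurable W) : Monotone fun c => ∫ ε, min 1 (Real.exp (-(W ε - c))) ∂μ := by
  intro c c' hcc'
  refine integral_mono (integrable_min_one_exp μ (hW.sub measurable_const).neg)
    (integrable_min_one_exp μ (hW.sub measurable_const).neg) fun ε => ?_
  exact min_le_min_left 1 (Real.exp_le_exp.2 (by linarith))

/-- **`c ↦ a_R(c) = E_μ[min(1, e^{W−c})]` is non-increasing** (raising the level constant makes every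
down-switch less acceptable). -/
theorem integral_accept_rev_anti (μ : Measure E) [IsProbabilityMeasure μ] {W : E → ℝ}
    (hW : Measurable W) : Antitone fun c => ∫ ε, min 1 (Real.exp (W ε - c)) ∂μ := by
  intro c c' hcc'
  refine integral_mono (integrable_min_one_exp μ (hW.sub measurable_const))
    (integrable_min_one_exp μ (hW.sub measurable_const)) fun ε => ?_
  exact min_le_min_left 1 (Real.exp_le_exp.2 (by linarith))

/-- `2σ(x) ≤ e^{x}` for `x ≥ 0` (i.e. `2 ≤ 1 + e^{x}`). -/
theorem two_mul_sigmoid_le_exp {x : ℝ} (hx : 0 ≤ x) : 2 * Real.sigmoid x ≤ Real.exp x := by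
  have h1 : 1 ≤ Real.exp x := Real.one_le_exp hx
  have hpos : 0 < 1 + Real.exp (-x) := by positivity
  rw [Real.sigmoid_def, ← div_eq_mul_inv, div_le_iff₀ hpos, mul_add, mul_one, ← Real.exp_add,
    add_neg_cancel, Real.exp_zero]
  linarith

/-- `e^{−x} ≤ 2σ(−x)` for `x ≥ 0` (i.e. `1 + e^{x} ≤ 2e^{x}`). -/
theorem exp_neg_le_two_mul_sigmoid_neg {x : ℝ} (hx : 0 ≤ x) :
    Real.exp (-x) ≤ 2 * Real.sigmoid (-x) := by
  have h1 : Real.exp (-x) ≤ 1 := Real.exp_le_one_iff.2 (neg_nonpos.2 hx)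
  have hpos : 0 < 1 + Real.exp x := by positivity
  rw [Real.sigmoid_def, neg_neg, ← div_eq_mul_inv, le_div_iff₀ hpos, mul_add, mul_one,
    ← Real.exp_add, neg_add_cancel, Real.exp_zero]
  linarith

namespace CrooksPair

variable {ν₀ ν₁ : Measure Ω} {κF κR : Kernel Ω E} {s e : E → Ω} {W : E → ℝ}

/-! ## The two-sided sandwich around the BAR root -/

/-- **Upper sandwich**: `rate(c) ≤ 2σ(|c − ΔF|) · a_F(ΔF)` for every level constant `c`. -/
theorem switchRate_le_two_mul_sigmoid_mul_accept [IsFiniteMeasure ν₀] [IsFiniteMeasure ν₁]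
    [IsMarkovKernel κF] [IsMarkovKernel κR] (h0 : ν₀ univ ≠ 0) (h1 : ν₁ univ ≠ 0)
    (h : CrooksPair ν₀ ν₁ κF κR s e W) (c : ℝ) {ΔF : ℝ}
    (hΔF : Real.exp (-ΔF) = ((ν₀ univ)⁻¹ * ν₁ univ).toReal) :
    (1 - (jointWeight c ν₀ ν₁ (targetLevel Ω)).toReal / (jointWeight c ν₀ ν₁ univ).toReal) *
          ∫ ε, min 1 (Real.exp (-(W ε - c))) ∂(fwdPathLaw ν₀ κF) +
        (jointWeight c ν₀ ν₁ (targetLevel Ω)).toReal / (jointWeight c ν₀ ν₁ univ).toReal *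
          ∫ ε, min 1 (Real.exp (W ε - c)) ∂(fwdPathLaw ν₁ κR) ≤
      2 * Real.sigmoid (|c - ΔF|) * ∫ ε, min 1 (Real.exp (-(W ε - ΔF))) ∂(fwdPathLaw ν₀ κF) := by
  haveI := isProbabilityMeasure_fwdPathLaw ν₀ h0 κF
  haveI := isProbabilityMeasure_fwdPathLaw ν₁ h1 κR
  have hocc := occupancy_eq_sigmoid c ν₀ ν₁ h0 h1 hΔF
  rcases le_total c ΔF with hc | hc
  · -- `c ≤ ΔF`: up-flow form, `1 − p = σ(ΔF − c) = σ(|c − ΔF|)`, `a_F(c) ≤ a_F(ΔF)`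
    rw [h.switchRate_eq_two_mul h0 h1 c, hocc, ← Real.sigmoid_neg, abs_of_nonpos (by linarith),
      mul_assoc]
    exact mul_le_mul_of_nonneg_left (mul_le_mul_of_nonneg_left
      (integral_accept_mono (fwdPathLaw ν₀ κF) h.measurable_W hc) (Real.sigmoid_nonneg _)) two_pos.le
  · -- `ΔF ≤ c`: down-flow form, `p = σ(c − ΔF) = σ(|c − ΔF|)`, `a_R(c) ≤ a_R(ΔF) = a_F(ΔF)`
    rw [h.switchRate_eq_two_mul_rev h0 h1 c, hocc, abs_of_nonneg (by linarith), mul_assoc,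
      ← h.integral_accept_rev_eq h0 h1 hΔF]
    exact mul_le_mul_of_nonneg_left (mul_le_mul_of_nonneg_left
      (integral_accept_rev_anti (fwdPathLaw ν₁ κR) h.measurable_W hc) (Real.sigmoid_nonneg _))
      two_pos.le

/-- **Lower sandwich**: `2σ(−|c − ΔF|) · a_F(ΔF) ≤ rate(c)` for every level constant `c`. -/
theorem two_mul_sigmoid_mul_accept_le_switchRate [IsFiniteMeasure ν₀] [IsFiniteMeasure ν₁]
    [IsMarkovKernel κF] [IsMarkovKernel κR] (h0 : ν₀ univ ≠ 0) (h1 : ν₁ univ ≠ 0)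
    (h : CrooksPair ν₀ ν₁ κF κR s e W) (c : ℝ) {ΔF : ℝ}
    (hΔF : Real.exp (-ΔF) = ((ν₀ univ)⁻¹ * ν₁ univ).toReal) :
    2 * Real.sigmoid (-|c - ΔF|) * ∫ ε, min 1 (Real.exp (-(W ε - ΔF))) ∂(fwdPathLaw ν₀ κF) ≤
      (1 - (jointWeight c ν₀ ν₁ (targetLevel Ω)).toReal / (jointWeight c ν₀ ν₁ univ).toReal) *
          ∫ ε, min 1 (Real.exp (-(W ε - c))) ∂(fwdPathLaw ν₀ κF) +
        (jointWeight c ν₀ ν₁ (targetLevel Ω)).toReal / (jointWeight c ν₀ ν₁ univ).toReal *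
          ∫ ε, min 1 (Real.exp (W ε - c)) ∂(fwdPathLaw ν₁ κR) := by
  haveI := isProbabilityMeasure_fwdPathLaw ν₀ h0 κF
  haveI := isProbabilityMeasure_fwdPathLaw ν₁ h1 κR
  have hocc := occupancy_eq_sigmoid c ν₀ ν₁ h0 h1 hΔF
  rcases le_total c ΔF with hc | hc
  · -- `c ≤ ΔF`: down-flow form, `p = σ(c − ΔF) = σ(−|c − ΔF|)`, `a_R(c) ≥ a_R(ΔF) = a_F(ΔF)`
    rw [h.switchRate_eq_two_mul_rev h0 h1 c, hocc, abs_of_nonpos (by linarith), neg_neg, mul_assoc,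
      ← h.integral_accept_rev_eq h0 h1 hΔF]
    exact mul_le_mul_of_nonneg_left (mul_le_mul_of_nonneg_left
      (integral_accept_rev_anti (fwdPathLaw ν₁ κR) h.measurable_W hc) (Real.sigmoid_nonneg _))
      two_pos.le
  · -- `ΔF ≤ c`: up-flow form, `1 − p = σ(ΔF − c) = σ(−|c − ΔF|)`, `a_F(c) ≥ a_F(ΔF)`
    rw [h.switchRate_eq_two_mul h0 h1 c, hocc, ← Real.sigmoid_neg, abs_of_nonneg (by linarith),
      mul_assoc]
    exact mul_le_mul_of_nonneg_left (mul_le_mul_of_nonneg_left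
      (integral_accept_mono (fwdPathLaw ν₀ κF) h.measurable_W hc) (Real.sigmoid_nonneg _)) two_pos.le

/-! ## Factor-two optimality of the BAR root and the exponential bracket -/

/-- **The BAR root is optimal within a factor two**: `rate(c) ≤ 2 · rate(ΔF)` for every `c`
(`rate(ΔF) = a_F(ΔF)`, `NCMCGeneralSpaceSwitchRate.switchRate_freeEnergyDiff`; `σ ≤ 1`). -/
theorem switchRate_le_two_mul_switchRate_freeEnergyDiff [IsFiniteMeasure ν₀] [IsFiniteMeasure ν₁]
    [IsMarkovKernel κF] [IsMarkovKernel κR] (h0 : ν₀ univ ≠ 0) (h1 : ν₁ univ ≠ 0)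
    (h : CrooksPair ν₀ ν₁ κF κR s e W) (c : ℝ) {ΔF : ℝ}
    (hΔF : Real.exp (-ΔF) = ((ν₀ univ)⁻¹ * ν₁ univ).toReal) :
    (1 - (jointWeight c ν₀ ν₁ (targetLevel Ω)).toReal / (jointWeight c ν₀ ν₁ univ).toReal) *
          ∫ ε, min 1 (Real.exp (-(W ε - c))) ∂(fwdPathLaw ν₀ κF) +
        (jointWeight c ν₀ ν₁ (targetLevel Ω)).toReal / (jointWeight c ν₀ ν₁ univ).toReal *
          ∫ ε, min 1 (Real.exp (W ε - c)) ∂(fwdPathLaw ν₁ κR) ≤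
      2 * ((1 - (jointWeight ΔF ν₀ ν₁ (targetLevel Ω)).toReal / (jointWeight ΔF ν₀ ν₁ univ).toReal) *
          ∫ ε, min 1 (Real.exp (-(W ε - ΔF))) ∂(fwdPathLaw ν₀ κF) +
        (jointWeight ΔF ν₀ ν₁ (targetLevel Ω)).toReal / (jointWeight ΔF ν₀ ν₁ univ).toReal *
          ∫ ε, min 1 (Real.exp (W ε - ΔF)) ∂(fwdPathLaw ν₁ κR)) := by
  rw [h.switchRate_freeEnergyDiff h0 h1 hΔF]
  refine (h.switchRate_le_two_mul_sigmoid_mul_accept h0 h1 c hΔF).trans ?_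
  have ha : 0 ≤ ∫ ε, min 1 (Real.exp (-(W ε - ΔF))) ∂(fwdPathLaw ν₀ κF) :=
    integral_nonneg fun ε => le_min zero_le_one (Real.exp_pos _).le
  nlinarith [Real.sigmoid_le_one (|c - ΔF|), mul_le_mul_of_nonneg_right
    (Real.sigmoid_le_one (|c - ΔF|)) ha]

/-- **Exponential bracket, upper half**: `rate(c) ≤ e^{|c − ΔF|} · rate(ΔF)`. -/
theorem switchRate_le_exp_mul [IsFiniteMeasure ν₀] [IsFiniteMeasure ν₁]
    [IsMarkovKernel κF] [IsMarkovKernel κR] (h0 : ν₀ univ ≠ 0) (h1 : ν₁ univ ≠ 0)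
    (h : CrooksPair ν₀ ν₁ κF κR s e W) (c : ℝ) {ΔF : ℝ}
    (hΔF : Real.exp (-ΔF) = ((ν₀ univ)⁻¹ * ν₁ univ).toReal) :
    (1 - (jointWeight c ν₀ ν₁ (targetLevel Ω)).toReal / (jointWeight c ν₀ ν₁ univ).toReal) *
          ∫ ε, min 1 (Real.exp (-(W ε - c))) ∂(fwdPathLaw ν₀ κF) +
        (jointWeight c ν₀ ν₁ (targetLevel Ω)).toReal / (jointWeight c ν₀ ν₁ univ).toReal *
          ∫ ε, min 1 (Real.exp (W ε - c)) ∂(fwdPathLaw ν₁ κR) ≤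
      Real.exp (|c - ΔF|) *
        ((1 - (jointWeight ΔF ν₀ ν₁ (targetLevel Ω)).toReal / (jointWeight ΔF ν₀ ν₁ univ).toReal) *
          ∫ ε, min 1 (Real.exp (-(W ε - ΔF))) ∂(fwdPathLaw ν₀ κF) +
        (jointWeight ΔF ν₀ ν₁ (targetLevel Ω)).toReal / (jointWeight ΔF ν₀ ν₁ univ).toReal *
          ∫ ε, min 1 (Real.exp (W ε - ΔF)) ∂(fwdPathLaw ν₁ κR)) := by
  rw [h.switchRate_freeEnergyDiff h0 h1 hΔF]
  refine (h.switchRate_le_two_mul_sigmoid_mul_accept h0 h1 c hΔF).trans ?_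
  exact mul_le_mul_of_nonneg_right (two_mul_sigmoid_le_exp (abs_nonneg _))
    (integral_nonneg fun ε => le_min zero_le_one (Real.exp_pos _).le)

/-- **Exponential bracket, lower half**: `e^{−|c − ΔF|} · rate(ΔF) ≤ rate(c)`. -/
theorem exp_neg_mul_le_switchRate [IsFiniteMeasure ν₀] [IsFiniteMeasure ν₁]
    [IsMarkovKernel κF] [IsMarkovKernel κR] (h0 : ν₀ univ ≠ 0) (h1 : ν₁ univ ≠ 0)
    (h : CrooksPair ν₀ ν₁ κF κR s e W) (c : ℝ) {ΔF : ℝ}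
    (hΔF : Real.exp (-ΔF) = ((ν₀ univ)⁻¹ * ν₁ univ).toReal) :
    Real.exp (-|c - ΔF|) *
        ((1 - (jointWeight ΔF ν₀ ν₁ (targetLevel Ω)).toReal / (jointWeight ΔF ν₀ ν₁ univ).toReal) *
          ∫ ε, min 1 (Real.exp (-(W ε - ΔF))) ∂(fwdPathLaw ν₀ κF) +
        (jointWeight ΔF ν₀ ν₁ (targetLevel Ω)).toReal / (jointWeight ΔF ν₀ ν₁ univ).toReal *
          ∫ ε, min 1 (Real.exp (W ε - ΔF)) ∂(fwdPathLaw ν₁ κR)) ≤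
      (1 - (jointWeight c ν₀ ν₁ (targetLevel Ω)).toReal / (jointWeight c ν₀ ν₁ univ).toReal) *
          ∫ ε, min 1 (Real.exp (-(W ε - c))) ∂(fwdPathLaw ν₀ κF) +
        (jointWeight c ν₀ ν₁ (targetLevel Ω)).toReal / (jointWeight c ν₀ ν₁ univ).toReal *
          ∫ ε, min 1 (Real.exp (W ε - c)) ∂(fwdPathLaw ν₁ κR) := by
  rw [h.switchRate_freeEnergyDiff h0 h1 hΔF]
  refine le_trans ?_ (h.two_mul_sigmoid_mul_accept_le_switchRate h0 h1 c hΔF)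
  exact mul_le_mul_of_nonneg_right (exp_neg_le_two_mul_sigmoid_neg (abs_nonneg _))
    (integral_nonneg fun ε => le_min zero_le_one (Real.exp_pos _).le)

/-- **The switch rate is 1-log-Lipschitz in the level constant around the BAR root**:
`|log rate(c) − log rate(ΔF)| ≤ |c − ΔF|` whenever `rate(ΔF) > 0` (i.e. `P_F` and `P_R` are not
mutually singular). -/
theorem abs_log_switchRate_sub_le [IsFiniteMeasure ν₀] [IsFiniteMeasure ν₁]
    [IsMarkovKernel κF] [IsMarkovKernel κR] (h0 : ν₀ univ ≠ 0) (h1 : ν₁ univ ≠ 0)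
    (h : CrooksPair ν₀ ν₁ κF κR s e W) (c : ℝ) {ΔF : ℝ}
    (hΔF : Real.exp (-ΔF) = ((ν₀ univ)⁻¹ * ν₁ univ).toReal)
    (hpos : 0 < (1 - (jointWeight ΔF ν₀ ν₁ (targetLevel Ω)).toReal / (jointWeight ΔF ν₀ ν₁ univ).toReal) *
          ∫ ε, min 1 (Real.exp (-(W ε - ΔF))) ∂(fwdPathLaw ν₀ κF) +
        (jointWeight ΔF ν₀ ν₁ (targetLevel Ω)).toReal / (jointWeight ΔF ν₀ ν₁ univ).toReal *
          ∫ ε, min 1 (Real.exp (W ε - ΔF)) ∂(fwdPathLaw ν₁ κR)) :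
    |Real.log ((1 - (jointWeight c ν₀ ν₁ (targetLevel Ω)).toReal / (jointWeight c ν₀ ν₁ univ).toReal) *
          ∫ ε, min 1 (Real.exp (-(W ε - c))) ∂(fwdPathLaw ν₀ κF) +
        (jointWeight c ν₀ ν₁ (targetLevel Ω)).toReal / (jointWeight c ν₀ ν₁ univ).toReal *
          ∫ ε, min 1 (Real.exp (W ε - c)) ∂(fwdPathLaw ν₁ κR)) -
      Real.log ((1 - (jointWeight ΔF ν₀ ν₁ (targetLevel Ω)).toReal / (jointWeight ΔF ν₀ ν₁ univ).toReal) *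
          ∫ ε, min 1 (Real.exp (-(W ε - ΔF))) ∂(fwdPathLaw ν₀ κF) +
        (jointWeight ΔF ν₀ ν₁ (targetLevel Ω)).toReal / (jointWeight ΔF ν₀ ν₁ univ).toReal *
          ∫ ε, min 1 (Real.exp (W ε - ΔF)) ∂(fwdPathLaw ν₁ κR))| ≤ |c - ΔF| := by
  set r := (1 - (jointWeight c ν₀ ν₁ (targetLevel Ω)).toReal / (jointWeight c ν₀ ν₁ univ).toReal) *
          ∫ ε, min 1 (Real.exp (-(W ε - c))) ∂(fwdPathLaw ν₀ κF) +
        (jointWeight c ν₀ ν₁ (targetLevel Ω)).toReal / (jointWeight c ν₀ ν₁ univ).toReal *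
          ∫ ε, min 1 (Real.exp (W ε - c)) ∂(fwdPathLaw ν₁ κR) with hr
  set r₀ := (1 - (jointWeight ΔF ν₀ ν₁ (targetLevel Ω)).toReal / (jointWeight ΔF ν₀ ν₁ univ).toReal) *
          ∫ ε, min 1 (Real.exp (-(W ε - ΔF))) ∂(fwdPathLaw ν₀ κF) +
        (jointWeight ΔF ν₀ ν₁ (targetLevel Ω)).toReal / (jointWeight ΔF ν₀ ν₁ univ).toReal *
          ∫ ε, min 1 (Real.exp (W ε - ΔF)) ∂(fwdPathLaw ν₁ κR) with hr₀
  have hup : r ≤ Real.exp (|c - ΔF|) * r₀ := h.switchRate_le_exp_mul h0 h1 c hΔF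
  have hlo : Real.exp (-|c - ΔF|) * r₀ ≤ r := h.exp_neg_mul_le_switchRate h0 h1 c hΔF
  have hrpos : 0 < r := lt_of_lt_of_le (mul_pos (Real.exp_pos _) hpos) hlo
  rw [← Real.log_div hrpos.ne' hpos.ne', abs_le]
  constructor
  · rw [← Real.log_exp (-|c - ΔF|)]
    exact Real.log_le_log (Real.exp_pos _) ((le_div_iff₀ hpos).2 hlo)
  · rw [← Real.log_exp (|c - ΔF|)]
    exact Real.log_le_log (div_pos hrpos hpos) ((div_le_iff₀ hpos).2 hup)

end CrooksPair

end Summit.Ventures.LatticeQCDFlow.Exactness.GeneralNCMC
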